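import Summits.HodgeConjecture.CorCM.MultiFieldWeilSharedQuadraticFamilies
import Summits.HodgeConjecture.CorCM.MultiFieldWeilSeparatedThreefoldFactorsWitnessed
import HarnessLib

/-!
# MULTI-FIELD WEIL ENGINE — ON THE VARIETY: a complex abelian variety of CM type with simple isogeny factors of dimension `≤ 3` whose non-isogenous THREEFOLD factors
# sharing an imaginary quadratic field have NON-ISOMORPHIC CM fields, whose threefold factors sharing none have different Galois closures, and whose SURFACE factors
# contain no dihedral triple, satisfies the Hodge conjecture together with everything dominated by its powers — given ONLY Markman's fourfold theorem

Cell `pub-hodgecm2` (COR-CM), seat b30 gen 36 (2026-08-25); count-neutral own lane MULTI-FIELD WEIL ENGINE (stem `MultiFieldWeil*`) — the INTRINSIC form of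
`CorCM/MultiFieldWeilSharedQuadraticFamilies.lean` (W3) read on the variety through Milne's regrouping (`exists_isIsogeny_biproduct_of_isSimple_of_isOfCMType`, seat b16), in
the pattern of `CorCM/MultiFieldWeilSeparatedThreefoldFactors.lean` (R8: pairwise SEPARATED threefold factors) which it extends by whole GROUPS of threefold factors through
one imaginary quadratic field.  Theorems only; no definition, no named fact, no `sorry`.  HONEST FRAMING: conditional on the displayed Markman fourfold binder only; `HC_CM`
is NOT proved and not asserted — a statement about a NAMED CLASS of CM abelian varieties.

THE STATEMENT (**`hodgeConjectureFor_of_avDominatedBy_powSucc_of_isOfCMType_of_sharedQuadratic_threefold_factors_of_markman`**).  Let `X` be a complex abelian variety of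
CM type such that (a) every simple isogeny factor has dimension `≤ 3`; (b) for any two NON-isogenous simple threefold factors `B₀ ⊨ (K₀; Φ₀)`, `B₁ ⊨ (K₁; Φ₁)` (all CM
realisations): (Q1) if a totally complex quadratic subfield of `K₀` embeds in `K₁` then `Hom(K₀, K₁) = ∅` (the sextic fields are NOT isomorphic), and (Q2) if none does
then the Galois closures of `K₀`, `K₁` in `ℂ` differ; (c) no three pairwise non-isogenous simple surface factors have CM fields sharing one Galois closure.  Then EVERY complex
abelian variety dominated by a power `X^{N+1}` satisfies the Hodge conjecture, GIVEN ONLY `Markman2025_weilClasses_algebraic_abelianFourfold`.  In words: **up to isogeny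
`X = ∏ E_e^{n_e} × ∏ S_s^{m_s} × ∏_k ∏_{t ∈ G_k} T_t^{a_t} × ∏_u T_u^{b_u}` with ANY CM elliptic curves, simple CM surfaces without a dihedral triple, for each imaginary
quadratic field `k` ANY NUMBER of simple CM threefolds `T_t` with PAIRWISE NON-ISOMORPHIC sextic CM fields through `k`, and simple CM threefolds `T_u` whose fields contain no
imaginary quadratic field — all of pairwise different Galois closures across the groups and the `T_u`.**  §2 gives the WITNESSED form (hypotheses checked on ONE realisation
per factor; the CM field of a simple CM abelian variety is unique up to isomorphism, `exists_ringEquiv_forall_mem_iff_of_isIsogenous`).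

HONEST LIMITS: non-isogenous threefold factors with ISOMORPHIC CM fields (seat b16's (ii′); a single such pair is `CorCM/MultiFieldWeilAtMostTwoThreefoldTwoSurfaceFactors`);
the sister coincidences `k·L_F = k′·L_{F′}`; two fields without imaginary quadratic subfield in one Galois closure; the dihedral surface triple.

[cite: MoonenZarhin1999LowDim, Thm. (0.1), Thm. (0.2), §3 (3.1), Cor. (3.9), §5 (5.2)] [cite: Markman2025SurveySecant, Thm. 1.2] [cite: Milne1999LefschetzClasses, §1 Prop. 1.1]
[cite: MilneCM2006, Ch. I Prop. 3.13] [cite: Dodson1984, §5.1.2 Theorem] [cite: MumfordAV1970, §19 Thm. 1, Cor. 1–2 and p. 169] [cite: Gordon1999HodgeAVSurvey, §3 Theorem (proof), 7.4–7.7]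

## References
* [MoonenZarhin1999LowDim] B. Moonen, Yu. Zarhin, Math. Ann. 315 (1999) 711–733.  [Markman2025SurveySecant] E. Markman, arXiv:2509.23403, Thm. 1.2.
  [Milne1999LefschetzClasses] J. S. Milne, Duke Math. J. 96 (1999), §1 Prop. 1.1.  [MilneCM2006] J. S. Milne, *Complex Multiplication*, Ch. I Prop. 3.13.  [Dodson1984]
  B. Dodson, Trans. AMS 283 (1984), §5.1.2.  [MumfordAV1970] D. Mumford, *Abelian Varieties*, §19.  [Gordon1999HodgeAVSurvey] B. B. Gordon, *A survey of the Hodge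
  conjecture for abelian varieties*, §3, 7.4–7.7.
-/

noncomputable section

open CategoryTheory CategoryTheory.Limits NumberField IntermediateField

namespace Summit.HodgeConjecture.CorCM.MultiFieldWeil

open Literature.AlgebraicGeometry Literature.AlgebraicGeometry.Motives Literature.AlgebraicGeometry.HodgeTheory
open Literature.AlgebraicGeometry.Motives.AbelianVariety
open Literature.AlgebraicGeometry.ComplexMultiplication (IsCMTypeRealisation exists_ringEquiv_forall_mem_iff_of_isIsogenous)
open Literature.AlgebraicTopology.SingularHomology
open Literature.NumberTheory.ComplexMultiplication
open Literature.AlgebraicGeometry.Milne1999 (IsOfCMType)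
open Summit.HodgeConjecture.CorCM.Domination

open scoped Classical

section OnTheVariety

variable {X : AbelianVariety ℂ}

/-- Powers of a zero-dimensional abelian variety are zero-dimensional. [folklore] -/
private theorem dim_powSucc_eq_zero₃₆f (h0 : X.dim = 0) : ∀ N : ℕ, (X.powSucc N).dim = 0
  | 0 => h0
  | N + 1 => by rw [powSucc_succ, dim_prod, dim_powSucc_eq_zero₃₆f h0 N, h0]

/-- **MAIN THEOREM (on the variety) — THREEFOLD FACTORS SHARING AN IMAGINARY QUADRATIC FIELD HAVE NON-ISOMORPHIC CM FIELDS, THOSE SHARING NONE HAVE DIFFERENT GALOIS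
CLOSURES; NO DIHEDRAL SURFACE TRIPLE; ANY ELLIPTIC FACTORS — given ONLY Markman's fourfold theorem.**  `X` of CM type; (a) simple isogeny factors of dimension `≤ 3`; (b) for
any two non-isogenous simple threefold factors and all CM realisations `B₀ ⊨ (K₀; Φ₀)`, `B₁ ⊨ (K₁; Φ₁)`: a totally complex quadratic `F ≤ K₀` embedding in `K₁` forces
`Hom(K₀, K₁) = ∅`, and no such `F` forces `L(K₀) ≠ L(K₁)`; (c) no three pairwise non-isogenous simple surface factors with CM realisations sharing one Galois closure.  Then
everything dominated by a power `X^{N+1}` satisfies the Hodge conjecture, GIVEN ONLY `Markman2025_weilClasses_algebraic_abelianFourfold`.  `HC_CM` is NOT asserted.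
[cite: Milne1999LefschetzClasses, §1 Prop. 1.1] [cite: MoonenZarhin1999LowDim, Thm. (0.1), (0.2), §3 (3.1), Cor. (3.9)] [cite: Markman2025SurveySecant, Thm. 1.2]
[cite: Dodson1984, §5.1.2 Theorem] [cite: MumfordAV1970, §19 Thm. 1, Cor. 1–2] -/
theorem hodgeConjectureFor_of_avDominatedBy_powSucc_of_isOfCMType_of_sharedQuadratic_threefold_factors_of_markman
    (hW4 : Markman2025_weilClasses_algebraic_abelianFourfold) (hcm : IsOfCMType X)
    (h3 : ∀ B : AbelianVariety ℂ, B.IsSimple → AVDominatedBy B X → B.dim ≤ 3)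
    (hT : ∀ B₀ B₁ : AbelianVariety ℂ, B₀.IsSimple → B₁.IsSimple → AVDominatedBy B₀ X → AVDominatedBy B₁ X → B₀.dim = 3 → B₁.dim = 3 → ¬ IsIsogenous B₀ B₁ →
      ∀ (K₀ : Type) [Field K₀] [NumberField K₀] [IsCMField K₀] (Φ₀ : CMType K₀) (ι₀ : 𝓞 K₀ →+* End B₀) (θ₀ : K₀ →+* Module.End ℂ (complexBetti B₀.X 1))
        (K₁ : Type) [Field K₁] [NumberField K₁] [IsCMField K₁] (Φ₁ : CMType K₁) (ι₁ : 𝓞 K₁ →+* End B₁) (θ₁ : K₁ →+* Module.End ℂ (complexBetti B₁.X 1)),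
        IsCMTypeRealisation Φ₀ B₀ ι₀ θ₀ → IsCMTypeRealisation Φ₁ B₁ ι₁ θ₁ →
          ((∃ F : IntermediateField ℚ K₀, Module.finrank ℚ F = 2 ∧ IsTotallyComplex F ∧ Nonempty (F →+* K₁)) → IsEmpty (K₀ →+* K₁)) ∧
          ((¬ ∃ F : IntermediateField ℚ K₀, Module.finrank ℚ F = 2 ∧ IsTotallyComplex F ∧ Nonempty (F →+* K₁)) → normalClosure ℚ K₀ ℂ ≠ normalClosure ℚ K₁ ℂ))
    (hS : ∀ B₀ B₁ B₂ : AbelianVariety ℂ, B₀.IsSimple → B₁.IsSimple → B₂.IsSimple → AVDominatedBy B₀ X → AVDominatedBy B₁ X → AVDominatedBy B₂ X →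
      B₀.dim = 2 → B₁.dim = 2 → B₂.dim = 2 → ¬ IsIsogenous B₀ B₁ → ¬ IsIsogenous B₀ B₂ → ¬ IsIsogenous B₁ B₂ →
      ∀ (K₀ : Type) [Field K₀] [NumberField K₀] [IsCMField K₀] (Φ₀ : CMType K₀) (ι₀ : 𝓞 K₀ →+* End B₀) (θ₀ : K₀ →+* Module.End ℂ (complexBetti B₀.X 1))
        (K₁ : Type) [Field K₁] [NumberField K₁] [IsCMField K₁] (Φ₁ : CMType K₁) (ι₁ : 𝓞 K₁ →+* End B₁) (θ₁ : K₁ →+* Module.End ℂ (complexBetti B₁.X 1))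
        (K₂ : Type) [Field K₂] [NumberField K₂] [IsCMField K₂] (Φ₂ : CMType K₂) (ι₂ : 𝓞 K₂ →+* End B₂) (θ₂ : K₂ →+* Module.End ℂ (complexBetti B₂.X 1)),
        IsCMTypeRealisation Φ₀ B₀ ι₀ θ₀ → IsCMTypeRealisation Φ₁ B₁ ι₁ θ₁ → IsCMTypeRealisation Φ₂ B₂ ι₂ θ₂ →
          ¬ (normalClosure ℚ K₀ ℂ = normalClosure ℚ K₁ ℂ ∧ normalClosure ℚ K₁ ℂ = normalClosure ℚ K₂ ℂ))
    {B : AbelianVariety ℂ} {N : ℕ} (hB : AVDominatedBy B (X.powSucc N)) : HodgeConjectureFor B.dim B.X := by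
  rcases Nat.eq_zero_or_pos X.dim with h0 | hX0
  · exact hodgeConjectureFor_of_isDivisorGenerated _ (isDivisorGenerated_of_avDominatedBy hB
      (Literature.AlgebraicGeometry.Pohlmann1968.isDivisorGenerated_of_dim_eq_zero _ (dim_powSucc_eq_zero₃₆f h0 N)))
  -- Milne's regrouping: `X ∼ ⨁_i A'_{cls i}`, `A'_c` simple, pairwise non-isogenous, CM-realised
  obtain ⟨C, _, K', _, _, _, Φ', A', ι', θ', m, cls, f, hA, hs, hniso, hcls, hf⟩ := exists_isIsogeny_biproduct_of_isSimple_of_isOfCMType (X := X) hX0 hcm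
  have hXP : AVDominatedBy X (⨁ fun i => A' (cls i)) := AVDominatedBy.of_isIsogeny_hom hf (AVDominatedBy.refl _)
  have hPX : AVDominatedBy (⨁ fun i => A' (cls i)) X := AVDominatedBy.of_isIsogeny_inv hf (AVDominatedBy.refl _)
  have hslot : ∀ c, AVDominatedBy (A' c) X := fun c => by
    obtain ⟨i, rfl⟩ := hcls c
    exact (avDominatedBy_biproduct_summand (fun i => A' (cls i)) i).trans hPX
  have hdim3 : ∀ c, (A' c).dim ≤ 3 := fun c => h3 _ (hs c) (hslot c)
  have hfin : ∀ c, Module.finrank ℚ (K' c) = 2 * (A' c).dim := fun c =>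
    Literature.AlgebraicGeometry.Pohlmann1968.finrank_eq_two_mul_dim_of_isCMTypeRealisation (hA c)
  -- (b) on the sextic slots
  have hQ : ∀ t t' : C, t ≠ t' → Module.finrank ℚ (K' t) = 6 → Module.finrank ℚ (K' t') = 6 →
      ((∃ F : IntermediateField ℚ (K' t), Module.finrank ℚ F = 2 ∧ IsTotallyComplex F ∧ Nonempty (F →+* K' t')) → IsEmpty (K' t →+* K' t')) ∧
      ((¬ ∃ F : IntermediateField ℚ (K' t), Module.finrank ℚ F = 2 ∧ IsTotallyComplex F ∧ Nonempty (F →+* K' t')) →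
        normalClosure ℚ (K' t) ℂ ≠ normalClosure ℚ (K' t') ℂ) := fun t t' hne ht ht' =>
    hT (A' t) (A' t') (hs t) (hs t') (hslot t) (hslot t') (by have := hfin t; omega) (by have := hfin t'; omega) (hniso t t' hne)
      (K' t) (Φ' t) (ι' t) (θ' t) (K' t') (Φ' t') (ι' t') (θ' t') (hA t) (hA t')
  -- (c) on the quartic slots
  have hS3 : ∀ i j l : C, Module.finrank ℚ (K' i) = 4 → Module.finrank ℚ (K' j) = 4 → Module.finrank ℚ (K' l) = 4 →
      normalClosure ℚ (K' i) ℂ = normalClosure ℚ (K' j) ℂ → normalClosure ℚ (K' j) ℂ = normalClosure ℚ (K' l) ℂ →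
      IsIsogenous (A' i) (A' j) ∨ IsIsogenous (A' i) (A' l) ∨ IsIsogenous (A' j) (A' l) := by
    intro i j l hi hj hl hLij hLjl
    by_cases hij : i = j
    · subst hij
      exact Or.inl (IsIsogenous.refl _)
    by_cases hil : i = l
    · subst hil
      exact Or.inr (Or.inl (IsIsogenous.refl _))
    by_cases hjl : j = l
    · subst hjl
      exact Or.inr (Or.inr (IsIsogenous.refl _))
    exact absurd ⟨hLij, hLjl⟩ (hS (A' i) (A' j) (A' l) (hs i) (hs j) (hs l) (hslot i) (hslot j) (hslot l) (by have := hfin i; omega)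
      (by have := hfin j; omega) (by have := hfin l; omega) (hniso i j hij) (hniso i l hil) (hniso j l hjl)
      (K' i) (Φ' i) (ι' i) (θ' i) (K' j) (Φ' j) (ι' j) (θ' j) (K' l) (Φ' l) (ι' l) (θ' l) (hA i) (hA j) (hA l))
  -- every power of `X` is dominated by a product of copies of the slots
  obtain ⟨n, π, hdom⟩ := exists_avDominatedBy_powSucc_biproduct_slots A' cls hXP N
  exact hodgeConjectureFor_of_avDominatedBy_prod_of_sharedQuadratic_isEmpty_ringHom_of_markman (I := C) hW4 hA hs hdim3 hQ hS3 π (hB.trans hdom)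

/-- **The Hodge conjecture for `X` itself and all its powers**, under (a)–(c), given only Markman's fourfold theorem. [cite: MoonenZarhin1999LowDim, Thm. (0.1), (0.2)]
[cite: Markman2025SurveySecant, Thm. 1.2] -/
theorem hodgeConjectureFor_powSucc_of_isOfCMType_of_sharedQuadratic_threefold_factors_of_markman (hW4 : Markman2025_weilClasses_algebraic_abelianFourfold)
    (hcm : IsOfCMType X) (h3 : ∀ B : AbelianVariety ℂ, B.IsSimple → AVDominatedBy B X → B.dim ≤ 3)
    (hT : ∀ B₀ B₁ : AbelianVariety ℂ, B₀.IsSimple → B₁.IsSimple → AVDominatedBy B₀ X → AVDominatedBy B₁ X → B₀.dim = 3 → B₁.dim = 3 → ¬ IsIsogenous B₀ B₁ →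
      ∀ (K₀ : Type) [Field K₀] [NumberField K₀] [IsCMField K₀] (Φ₀ : CMType K₀) (ι₀ : 𝓞 K₀ →+* End B₀) (θ₀ : K₀ →+* Module.End ℂ (complexBetti B₀.X 1))
        (K₁ : Type) [Field K₁] [NumberField K₁] [IsCMField K₁] (Φ₁ : CMType K₁) (ι₁ : 𝓞 K₁ →+* End B₁) (θ₁ : K₁ →+* Module.End ℂ (complexBetti B₁.X 1)),
        IsCMTypeRealisation Φ₀ B₀ ι₀ θ₀ → IsCMTypeRealisation Φ₁ B₁ ι₁ θ₁ →
          ((∃ F : IntermediateField ℚ K₀, Module.finrank ℚ F = 2 ∧ IsTotallyComplex F ∧ Nonempty (F →+* K₁)) → IsEmpty (K₀ →+* K₁)) ∧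
          ((¬ ∃ F : IntermediateField ℚ K₀, Module.finrank ℚ F = 2 ∧ IsTotallyComplex F ∧ Nonempty (F →+* K₁)) → normalClosure ℚ K₀ ℂ ≠ normalClosure ℚ K₁ ℂ))
    (hS : ∀ B₀ B₁ B₂ : AbelianVariety ℂ, B₀.IsSimple → B₁.IsSimple → B₂.IsSimple → AVDominatedBy B₀ X → AVDominatedBy B₁ X → AVDominatedBy B₂ X →
      B₀.dim = 2 → B₁.dim = 2 → B₂.dim = 2 → ¬ IsIsogenous B₀ B₁ → ¬ IsIsogenous B₀ B₂ → ¬ IsIsogenous B₁ B₂ →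
      ∀ (K₀ : Type) [Field K₀] [NumberField K₀] [IsCMField K₀] (Φ₀ : CMType K₀) (ι₀ : 𝓞 K₀ →+* End B₀) (θ₀ : K₀ →+* Module.End ℂ (complexBetti B₀.X 1))
        (K₁ : Type) [Field K₁] [NumberField K₁] [IsCMField K₁] (Φ₁ : CMType K₁) (ι₁ : 𝓞 K₁ →+* End B₁) (θ₁ : K₁ →+* Module.End ℂ (complexBetti B₁.X 1))
        (K₂ : Type) [Field K₂] [NumberField K₂] [IsCMField K₂] (Φ₂ : CMType K₂) (ι₂ : 𝓞 K₂ →+* End B₂) (θ₂ : K₂ →+* Module.End ℂ (complexBetti B₂.X 1)),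
        IsCMTypeRealisation Φ₀ B₀ ι₀ θ₀ → IsCMTypeRealisation Φ₁ B₁ ι₁ θ₁ → IsCMTypeRealisation Φ₂ B₂ ι₂ θ₂ →
          ¬ (normalClosure ℚ K₀ ℂ = normalClosure ℚ K₁ ℂ ∧ normalClosure ℚ K₁ ℂ = normalClosure ℚ K₂ ℂ))
    (N : ℕ) : HodgeConjectureFor (X.powSucc N).dim (X.powSucc N).X :=
  hodgeConjectureFor_of_avDominatedBy_powSucc_of_isOfCMType_of_sharedQuadratic_threefold_factors_of_markman hW4 hcm h3 hT hS (AVDominatedBy.refl _)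

/-! ## §2 The witnessed form: hypotheses checked on one CM realisation per factor -/

/-- **MAIN THEOREM (on the variety, witnessed).**  `X` of CM type; (a) simple isogeny factors of dimension `≤ 3`; (b) for any two NON-isogenous simple threefold factors
there EXIST CM realisations `B₀ ⊨ (K₀; Φ₀)`, `B₁ ⊨ (K₁; Φ₁)` with: a totally complex quadratic `F ≤ K₀` embedding in `K₁` forces `Hom(K₀, K₁) = ∅`, no such `F` forces
`L(K₀) ≠ L(K₁)`; (c) for any three pairwise non-isogenous simple surface factors there EXIST CM realisations whose fields do not share one Galois closure.  Then everything
dominated by a power `X^{N+1}` satisfies the Hodge conjecture, given ONLY Markman's fourfold theorem (the CM field of a simple CM abelian variety is unique up to isomorphism,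
and (b), (c) transport along field isomorphisms).  `HC_CM` is NOT asserted. [cite: MilneCM2006, Ch. I Prop. 3.13] [cite: Milne1999LefschetzClasses, §1 Prop. 1.1]
[cite: MoonenZarhin1999LowDim, Thm. (0.1), (0.2), §3 (3.1), Cor. (3.9)] [cite: Markman2025SurveySecant, Thm. 1.2] -/
theorem hodgeConjectureFor_of_avDominatedBy_powSucc_of_isOfCMType_of_witnessed_sharedQuadratic_threefold_factors_of_markman
    (hW4 : Markman2025_weilClasses_algebraic_abelianFourfold) (hcm : IsOfCMType X)
    (h3 : ∀ B : AbelianVariety ℂ, B.IsSimple → AVDominatedBy B X → B.dim ≤ 3)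
    (hT : ∀ B₀ B₁ : AbelianVariety ℂ, B₀.IsSimple → B₁.IsSimple → AVDominatedBy B₀ X → AVDominatedBy B₁ X → B₀.dim = 3 → B₁.dim = 3 → ¬ IsIsogenous B₀ B₁ →
      ∃ (K₀ : Type) (_ : Field K₀) (_ : NumberField K₀) (_ : IsCMField K₀) (Φ₀ : CMType K₀) (ι₀ : 𝓞 K₀ →+* End B₀) (θ₀ : K₀ →+* Module.End ℂ (complexBetti B₀.X 1))
        (K₁ : Type) (_ : Field K₁) (_ : NumberField K₁) (_ : IsCMField K₁) (Φ₁ : CMType K₁) (ι₁ : 𝓞 K₁ →+* End B₁) (θ₁ : K₁ →+* Module.End ℂ (complexBetti B₁.X 1)),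
        IsCMTypeRealisation Φ₀ B₀ ι₀ θ₀ ∧ IsCMTypeRealisation Φ₁ B₁ ι₁ θ₁ ∧
          ((∃ F : IntermediateField ℚ K₀, Module.finrank ℚ F = 2 ∧ IsTotallyComplex F ∧ Nonempty (F →+* K₁)) → IsEmpty (K₀ →+* K₁)) ∧
          ((¬ ∃ F : IntermediateField ℚ K₀, Module.finrank ℚ F = 2 ∧ IsTotallyComplex F ∧ Nonempty (F →+* K₁)) → normalClosure ℚ K₀ ℂ ≠ normalClosure ℚ K₁ ℂ))
    (hS : ∀ B₀ B₁ B₂ : AbelianVariety ℂ, B₀.IsSimple → B₁.IsSimple → B₂.IsSimple → AVDominatedBy B₀ X → AVDominatedBy B₁ X → AVDominatedBy B₂ X →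
      B₀.dim = 2 → B₁.dim = 2 → B₂.dim = 2 → ¬ IsIsogenous B₀ B₁ → ¬ IsIsogenous B₀ B₂ → ¬ IsIsogenous B₁ B₂ →
      ∃ (K₀ : Type) (_ : Field K₀) (_ : NumberField K₀) (_ : IsCMField K₀) (Φ₀ : CMType K₀) (ι₀ : 𝓞 K₀ →+* End B₀) (θ₀ : K₀ →+* Module.End ℂ (complexBetti B₀.X 1))
        (K₁ : Type) (_ : Field K₁) (_ : NumberField K₁) (_ : IsCMField K₁) (Φ₁ : CMType K₁) (ι₁ : 𝓞 K₁ →+* End B₁) (θ₁ : K₁ →+* Module.End ℂ (complexBetti B₁.X 1))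
        (K₂ : Type) (_ : Field K₂) (_ : NumberField K₂) (_ : IsCMField K₂) (Φ₂ : CMType K₂) (ι₂ : 𝓞 K₂ →+* End B₂) (θ₂ : K₂ →+* Module.End ℂ (complexBetti B₂.X 1)),
        IsCMTypeRealisation Φ₀ B₀ ι₀ θ₀ ∧ IsCMTypeRealisation Φ₁ B₁ ι₁ θ₁ ∧ IsCMTypeRealisation Φ₂ B₂ ι₂ θ₂ ∧
          ¬ (normalClosure ℚ K₀ ℂ = normalClosure ℚ K₁ ℂ ∧ normalClosure ℚ K₁ ℂ = normalClosure ℚ K₂ ℂ))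
    {B : AbelianVariety ℂ} {N : ℕ} (hB : AVDominatedBy B (X.powSucc N)) : HodgeConjectureFor B.dim B.X := by
  refine hodgeConjectureFor_of_avDominatedBy_powSucc_of_isOfCMType_of_sharedQuadratic_threefold_factors_of_markman hW4 hcm h3 ?_ ?_ hB
  · intro B₀ B₁ hs₀ hs₁ hd₀ hd₁ h3₀ h3₁ hni K₀ _ _ _ Φ₀ ι₀ θ₀ K₁ _ _ _ Φ₁ ι₁ θ₁ hA₀ hA₁
    obtain ⟨K₀', _, _, _, Φ₀', ι₀', θ₀', K₁', _, _, _, Φ₁', ι₁', θ₁', hA₀', hA₁', hQ1, hQ2⟩ := hT B₀ B₁ hs₀ hs₁ hd₀ hd₁ h3₀ h3₁ hni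
    -- the fields of two realisations of one simple variety are isomorphic
    obtain ⟨ε₀, -⟩ := exists_ringEquiv_forall_mem_iff_of_isIsogenous hA₀ hA₀' hs₀ (IsIsogenous.refl _)
    obtain ⟨ε₁, -⟩ := exists_ringEquiv_forall_mem_iff_of_isIsogenous hA₁ hA₁' hs₁ (IsIsogenous.refl _)
    refine ⟨fun h => ?_, fun h hL => ?_⟩
    · have he : IsEmpty (K₀' →+* K₁') := hQ1 (exists_quadratic_subfield_of_ringEquiv ε₀ ε₁ h)
      exact ⟨fun g => he.false (ε₁.toRingHom.comp (g.comp ε₀.symm.toRingHom))⟩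
    · refine hQ2 (fun h' => h (exists_quadratic_subfield_of_ringEquiv ε₀.symm ε₁.symm h')) ?_
      rw [← normalClosure_eq_of_ringEquiv ε₀, ← normalClosure_eq_of_ringEquiv ε₁, hL]
  · intro B₀ B₁ B₂ hs₀ hs₁ hs₂ hd₀ hd₁ hd₂ h2₀ h2₁ h2₂ hn₀₁ hn₀₂ hn₁₂ K₀ _ _ _ Φ₀ ι₀ θ₀ K₁ _ _ _ Φ₁ ι₁ θ₁ K₂ _ _ _ Φ₂ ι₂ θ₂ hA₀ hA₁ hA₂ h
    obtain ⟨K₀', _, _, _, Φ₀', ι₀', θ₀', K₁', _, _, _, Φ₁', ι₁', θ₁', K₂', _, _, _, Φ₂', ι₂', θ₂', hA₀', hA₁', hA₂', hL⟩ :=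
      hS B₀ B₁ B₂ hs₀ hs₁ hs₂ hd₀ hd₁ hd₂ h2₀ h2₁ h2₂ hn₀₁ hn₀₂ hn₁₂
    obtain ⟨ε₀, -⟩ := exists_ringEquiv_forall_mem_iff_of_isIsogenous hA₀ hA₀' hs₀ (IsIsogenous.refl _)
    obtain ⟨ε₁, -⟩ := exists_ringEquiv_forall_mem_iff_of_isIsogenous hA₁ hA₁' hs₁ (IsIsogenous.refl _)
    obtain ⟨ε₂, -⟩ := exists_ringEquiv_forall_mem_iff_of_isIsogenous hA₂ hA₂' hs₂ (IsIsogenous.refl _)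
    apply hL
    rw [← normalClosure_eq_of_ringEquiv ε₀, ← normalClosure_eq_of_ringEquiv ε₁, ← normalClosure_eq_of_ringEquiv ε₂]
    exact h

end OnTheVariety

end Summit.HodgeConjecture.CorCM.MultiFieldWeil

end
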